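import Literature.NumberTheory.Sieve.ChenTheorem
import Literature.NumberTheory.Sieve.ChenTheoremWeightedSieveProofs
import Literature.NumberTheory.Sieve.ChenSieveProduct
import Literature.NumberTheory.Sieve.ChenSiftedLower
import Literature.NumberTheory.Sieve.ChenSiftedDvdUpper
import Literature.NumberTheory.Sieve.ChenSwitchedUpper
import HarnessLib

/-!
# Chen's theorem `N = p + P₂` (Nathanson, Thm 10.1) — PROVED

Topic `Literature/NumberTheory/Sieve`. `ChenTheorem.lean` vendors the architecture of the printed
proof of Chen's theorem (M. B. Nathanson, *Additive Number Theory: The Classical Bases*, GTM 164,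
Springer 1996, Ch. 10) as the named facts `chen_weighted_sieve_inequality` (Thm 10.2),
`chen_sieveProduct_estimate` (Thm 10.3), `chen_sifted_lower` (Thm 10.4), `chen_siftedDvd_upper`
(Thm 10.5), `chen_switched_upper` (Thm 10.6), `chen_mainTermConstant_pos` (§10.8), and PROVES the
assembly of §10.8 ("Conclusion", p. 182 of the printed book) as `chen_repCount_lower_of_sieve`.
All six inputs are theorems of the tree:

* `chen_weighted_sieve_inequality_holds` (`ChenTheoremWeightedSieveProofs.lean`, Thm 10.2);
* `chen_sieveProduct_estimate_holds` (`ChenSieveProduct.lean`, Thm 10.3, Mertens);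
* `chen_sifted_lower_holds` (`ChenSiftedLower.lean`, Thm 10.4: the linear-sieve lower bound,
  Iwaniec's theorem and Bombieri–Vinogradov, all proved in the tree);
* `chen_siftedDvd_upper_holds` (`ChenSiftedDvdUpper.lean`, Thm 10.5);
* `chen_switched_upper_holds` (`ChenSwitchedUpper.lean`, Thm 10.6 with the bilinear-form
  inequality Thm 10.7, the large sieve and Siegel–Walfisz, all proved in the tree);
* `chen_mainTermConstant_pos_holds` (`ChenTheorem.lean`, `2 log 3 − log 6 − c > 0`);

so Theorem 10.1 itself, the named fact `Literature.NumberTheory.Sieve.Chen.chen_repCount_lower`,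
is discharged here, unconditionally:

  there are `c₀ > 0` and `N₀` with `r(N) ≥ c₀ · 𝔖(N) · 2N/(log N)²` for every even `N ≥ N₀`,

`r(N) = #{p ≤ N : p odd prime, N − p ∈ P₂}` (`Chen.repCount`), `𝔖(N)` the singular series (10.2)
(`Chen.singularSeries`).

(The corollary `Literature.NumberTheory.Sieve.chen_goldbach` — every large even `N` is `p + P₂` —
is already a theorem of the tree, `Literature.NumberTheory.Sieve.chen_goldbach_holds` of
`ChenTheoremIHolds.lean`, obtained there from Chen's original Theorem I; it also follows from the
present theorem by `chen_goldbach_of_repCount_lower`.)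

## References

* M. B. Nathanson, *Additive Number Theory: The Classical Bases*, GTM 164, Springer (1996),
  Theorem 10.1 (§10.1, p. 168) and its proof, §10.8 (p. 182). [Nathanson1996]
* J.-R. Chen, *On the representation of a larger even integer as the sum of a prime and the
  product of at most two primes*, Sci. Sinica 16 (1973), 157–176. [ChenSciSinica1973]
-/

namespace Literature.NumberTheory.Sieve.Chen

/-- **Chen's theorem** (Nathanson, Thm 10.1), PROVED: there are `c₀ > 0` and `N₀` such that
`r(N) ≥ c₀ · 𝔖(N) · 2N/(log N)²` for every even `N ≥ N₀`. The proof is Nathanson's §10.8: the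
weighted-sieve inequality (Thm 10.2), Mertens' formula for `V(z)` (Thm 10.3), the linear-sieve
lower bound for `S(A, 𝒫, z)` (Thm 10.4), the upper bound for `∑_q S(A_q, 𝒫, z)` (Thm 10.5), the
switching bound for `S(B, 𝒫, y)` (Thm 10.6, via the bilinear Bombieri–Vinogradov estimate
Thm 10.7) and `2 log 3 − log 6 − c > 0`, combined by `chen_repCount_lower_of_sieve`; every input is
the corresponding `_holds` theorem of the tree. [cite: Nathanson1996, Thm 10.1; proof §10.8] -/
theorem chen_repCount_lower_holds : chen_repCount_lower :=
  chen_repCount_lower_of_sieve chen_weighted_sieve_inequality_holds chen_sieveProduct_estimate_holds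
    chen_sifted_lower_holds chen_siftedDvd_upper_holds chen_switched_upper_holds
    chen_mainTermConstant_pos_holds

end Literature.NumberTheory.Sieve.Chen
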